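/-
Origin: expansion seat `prover-pub-hodgecm-mc-binder-2-g18-0`, handover #95 2026-08-20T22:11Z md5 14d73444421d (NEW; 103 l.; ns `HodgeCM.Model`; = binder-1-g17's `campaign/strike.py` applied to my certified 580a5f981860 (R1 ×1, R2 ×8: `(h₂ : SpecialCyclesAlgebraic)` binder gone, `hA h₂` → `hA`; 0 `h₂` tokens left); (J4a-pin) POINTWISE: **`hsmall_of_tower_at_of_scalar (hR hA R V c Char Adm Ω) (scalar : Char → L) (hreal) (hne) (hcite : «five sentences for LiuDictionary.ofTower hHD hI h₁ h₃ hA V Char Adm Ω (fun μ => ι₁ ∈ (lineType (scalar μ) _ _).1) (fun μ d => d.IsReflexOfTypeG ι₁ (lineType (scalar μ) _ _))») (hgood : R.GoodCtx ι₁ c) (hrec : SignRecipe.GoodCtx (orientBitι L ι₁) ι₁ c) (h6) (i) (hJS : ∃ S, (∀ μ ∈ S, scalar μ = c.D.a i) ∧ «#R120's hfam clause at S») : ∃ Γ₀, ∀ Γ ≤ Γ₀, ∃ M k σ', σ'.comp k = c.σ ∧ R.Theta V c i Γ ⊆ U.Uiso Γ M (inflate k (c.Ψ i)) σ'`** = #93r2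 `hsmall_of_tower_at_of_typeOf` at `typeOf := fun μ => SignRecipe.lineType (scalar μ) …` with the (J4a) clause supplied by #94 `liftTyped_of_scalar_eq` (theta-3-g26 K0 WORD l.14550: YES — `lineType ∘ scalar` IS Liu's `Φ_μ` on the guard); `hrec` = E's guard by `AdelicThetaCore.thetaModel_goodCtx_iff`. CERT lane farm lean-direct over `g18/farm/mirror2` = binder-1-g17's campaign mirror (RUN-63 PKG oleans + the 14 struck r2 oleans + #94): rc 0 ∕ 6 s ∕ 0 warn ∕ 0 proof holes (`g18/farm/logs/summary.tsv` row tagged campaign); `#print axioms` ⊆ trio and `#check` prints 0 `SpecialCyclesAlgebraic` (`g18/farm/logs/campaign-ax_camp.log` 470f2c475af5); also compiled by binder-1-g17 in `campaign/farm` (l.14545: rc 0 ∕ 6 s). FQN 0 ∕ 1. NAME LIST (theorems): `HodgeCM.Model.hsmall_of_tower_at_of_scalar`. (`HOME/mc/pub-hodgecm-mc-binder-2/g18/stage65/HodgeCM/Model/HsmallOfTowerAtLineType.lean`, md5 14d73444421d, 103 lines);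
landed by the gen-27 packager (p-g27) in gate run 65 as `HodgeCM/Model/HsmallOfTowerAtLineType.lean` (verbatim).
-/
/-
Copyright (c) 2026 the pub-hodgecm formalisation cell (harness21).  New file, not vendored.
Origin: session prover-pub-hodgecm-mc-binder-2-g18-0 (unit pub-hodgecm-mc-binder-2-g18, BINDER PROVER gen 18 of lineage mc-binder-2;
content lane (J-Liu-Θ), (J4a-pin) POINTWISE — E's `hsmall` through the tower in ONE call with the dictionary's type map PINNED
on the line scalar), 2026-08-20.  Intended final place: `HodgeCM/Model/HsmallOfTowerAtLineType.lean` (NEW additive leaf; imports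
binder-2's #93 `Model/HsmallOfTowerAtLiftType` and #94 `Model/Binders/JLiuLineType` (both RUN 64); nothing imports it).
-/
import Summits.HodgeConjecture.HodgeCM.Model.HsmallOfTowerAtLiftType
import Summits.HodgeConjecture.HodgeCM.Model.Binders.JLiuLineType

set_option autoImplicit false

/-!
# E's `hsmall` through the tower, POINTWISE, with `typeOf := Φ^δ ∘ scalar`

binder-2 #93 `hsmall_of_tower_at_of_typeOf` takes ONE type map `typeOf : Char → CMType L` (with `PhiMu`, `adm` defined from it)
and the (J4a)-typed datum `hJ4`.  If the theta lane pins the type map on the LINE SCALAR of the character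
(`typeOf μ := Φ^δ(scalar μ) = SignRecipe.lineType (scalar μ) …`, #94 — theta-3-g22's `Φ^δ_k(ι₁)`), then by #94
`liftTyped_of_scalar_eq` the (J4a) clause at the corner `(c, i)` is just `scalar μ = c.D.a i`, and E's `hsmall` at a point
follows from

  `hJS : ∃ S, (∀ μ ∈ S, scalar μ = c.D.a i) ∧ hfam S`

under E's guard in recipe form (`SignRecipe.GoodCtx (orientBitι L ι₁) ι₁ c`, = the theta model's `GoodCtx` by
`AdelicThetaCore.thetaModel_goodCtx_iff`) and E's scope conjunction `h6`.  This is the leanest E-facing socket binder-2 can offer: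
the junction-form child binds `scalar` (with its two side conditions) in place of `PhiMu`, `adm`, and a SCALAR EQUATION in place of
clauses 1–2 of `hJ`.  KERNEL: 1 theorem; 0 records, nothing cited, no `def … : Prop`.
-/

noncomputable section

open Function Set
open NumberField
open Literature.AlgebraicGeometry.Motives
open Literature.AlgebraicGeometry.ShimuraVarieties
open Literature.AlgebraicGeometry.HodgeTheory
open Literature.NumberTheory.Automorphic
open Literature.NumberTheory.Automorphic.PicardCM
open Literature.NumberTheory.Transcendental (Arapura2012_Cor_15_4_6)

namespace HodgeCM.Model

open HodgeCM.Model.TowerLevel HodgeCM.Model.TowerCarrier HodgeCM.Literature.Theta HodgeCM.Literature.Theta.LiuAlbaneseModuleDatum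
open HodgeCM.CMTypeOps (inflate)
open HodgeCM.Universe (ThetaModel)
open HodgeCM.SignRecipe (lineType)

variable (hHD : exists_isReal_hodgeModel) (hI : hodgePQ_independent_of_hodgeModel)
  (h₁ : BallQuotientUniformised) (h₃ : CMAbelianVarietyRealised)

/-- **E's `hsmall` THROUGH THE TOWER, POINTWISE, type map PINNED on the line scalar.**  One theta model `R`, one
`(L, ι₁, V, c, i)`; the tower dictionary at `V` with `PhiMu μ := ι₁ ∈ Φ^δ(scalar μ)`, `adm μ d := d.IsReflexOfTypeG ι₁ Φ^δ(scalar μ)`;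
the cited sentences for it; the theta model's good context AND the recipe-form good context of the bit of record; E's scope
conjunction; and a finite set `S` of characters with scalar `a_i` carrying (J4) families of component classes: the `hsmall`
clause of E at that point. -/
theorem hsmall_of_tower_at_of_scalar (hR : DeligneMilne1982_Thm_6_20_full) (hA : Arapura2012_Cor_15_4_6)
    (R : (picardCMUniverse hHD hI h₁ h₃).ThetaModel)
    {L : CMField} {ι₁ : L →+* ℂ} (V : HermSpace3 L ι₁) (c : SeesawCtx L)
    (Char : Type) (Adm : Char → Type) (Ω : (μ : Char) → Adm μ → Type)
    [∀ μ a, AddCommGroup (Ω μ a)] [∀ μ a, Module ℂ (Ω μ a)] [∀ μ a, Module (adelicAlgebra V) (Ω μ a)]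
    [∀ μ a, IsScalarTower ℂ (adelicAlgebra V) (Ω μ a)]
    (scalar : Char → L) (hreal : ∀ μ, conjRingHomK L (scalar μ) = scalar μ) (hne : ∀ μ, scalar μ ≠ 0)
    (hcite : (LiuDictionary.ofTower hHD hI h₁ h₃ hA V Char Adm Ω
        (fun μ => ι₁ ∈ (lineType (scalar μ) (hreal μ) (hne μ)).1)
        (fun μ d => d.IsReflexOfTypeG ι₁ (lineType (scalar μ) (hreal μ) (hne μ)))).Irreducible ∧
      (LiuDictionary.ofTower hHD hI h₁ h₃ hA V Char Adm Ω
        (fun μ => ι₁ ∈ (lineType (scalar μ) (hreal μ) (hne μ)).1)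
        (fun μ d => d.IsReflexOfTypeG ι₁ (lineType (scalar μ) (hreal μ) (hne μ)))).Prop413 ∧
      (LiuDictionary.ofTower hHD hI h₁ h₃ hA V Char Adm Ω
        (fun μ => ι₁ ∈ (lineType (scalar μ) (hreal μ) (hne μ)).1)
        (fun μ d => d.IsReflexOfTypeG ι₁ (lineType (scalar μ) (hreal μ) (hne μ)))).Thm418_2 ∧
      (LiuDictionary.ofTower hHD hI h₁ h₃ hA V Char Adm Ω
        (fun μ => ι₁ ∈ (lineType (scalar μ) (hreal μ) (hne μ)).1)
        (fun μ d => d.IsReflexOfTypeG ι₁ (lineType (scalar μ) (hreal μ) (hne μ)))).MuSeparated ∧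
      (LiuDictionary.ofTower hHD hI h₁ h₃ hA V Char Adm Ω
        (fun μ => ι₁ ∈ (lineType (scalar μ) (hreal μ) (hne μ)).1)
        (fun μ d => d.IsReflexOfTypeG ι₁ (lineType (scalar μ) (hreal μ) (hne μ)))).Thm418C)
    (hgood : R.GoodCtx ι₁ c) (hrec : SignRecipe.GoodCtx (Model.orientBitι L ι₁) ι₁ c)
    (h6 : Module.finrank ℚ c.K = 6 ∧ IsNormalClosure ℚ c.K L ∧ (Module.finrank ℚ L = 24 ∨ Module.finrank ℚ L = 48))
    (i : Fin 4)
    (hJS : ∃ S : Finset Char,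
        (∀ μ ∈ S, scalar μ = c.D.a i) ∧
        ∀ (Γ : Level V) (hΓ : Γ.BelowConjThree), ∀ ω ∈ R.Theta V c i Γ,
          ∃ cf : towerLevel hHD hI (ballQuotientUniformisedDatum_of h₁) h₃ hA Γ hΓ,
            TowerLevel.res hHD hI (ballQuotientUniformisedDatum_of h₁) h₃ hA cf = ω ∧
              (ofLevel hHD hI (ballQuotientUniformisedDatum_of h₁) h₃ hA Γ hΓ cf :
                  (LiuDictionary.ofTower hHD hI h₁ h₃ hA V Char Adm Ω
                    (fun μ => ι₁ ∈ (lineType (scalar μ) (hreal μ) (hne μ)).1)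
                    (fun μ d => d.IsReflexOfTypeG ι₁ (lineType (scalar μ) (hreal μ) (hne μ)))).H) ∈
                ⨆ μ ∈ S, (LiuDictionary.ofTower hHD hI h₁ h₃ hA V Char Adm Ω
                  (fun μ => ι₁ ∈ (lineType (scalar μ) (hreal μ) (hne μ)).1)
                  (fun μ d => d.IsReflexOfTypeG ι₁ (lineType (scalar μ) (hreal μ) (hne μ)))).block μ) :
    ∃ Γ₀ : Level V, ∀ Γ ≤ Γ₀,
      ∃ (M : CMField) (k : c.K →+* M) (σ' : M →+* ℂ), σ'.comp k = c.σ ∧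
        R.Theta V c i Γ ⊆ (picardCMUniverse hHD hI h₁ h₃).Uiso Γ M (inflate k (c.Ψ i)) σ' := by
  obtain ⟨S, hS, hfam⟩ := hJS
  exact hsmall_of_tower_at_of_typeOf hHD hI h₁ h₃ hR hA R V c Char Adm Ω
    (fun μ => lineType (scalar μ) (hreal μ) (hne μ)) hcite hgood h6 i
    ⟨S, fun μ hμ => liftTyped_of_scalar_eq scalar hreal hne _ (fun _ => rfl) h6.2.1 hrec (hS μ hμ), hfam⟩

end HodgeCM.Model

end
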